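import Mathlib.Tactic
import HarnessLib

/-!
# The commutation lemma for the numerator inclusion — algebraic skeleton

Kernel form of `widen/W1/KNEST-w1cx1.md` §5bis (b) (W1 cell pub-hsemireg): for two complexes with
SDR data `(i, p, h)`, `(i', p', h')` in code B's convention `x = κ(x) + d(h x) + i p x` (`κ` = the
`K`-component), and a chain map `ι` (the numerator inclusion, multiplication by the unit section
`s_p`) that carries the `K`-parts into `K`-parts — stated pointwise as «`h'` and `p'` kill `ι κ(x)`»
(degree 1) and «`h' d' (ι (h x)) = ι (h x)`» (degree 0: `ι(h x) ∈ 𝒦'⁰`, on which `h' d'` is the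
identity) —, one has `h' (ι x) = ι (h x) + h' (ι (i p x))` and `p' (ι x) = p' (ι (i p x))`.
So `h` commutes with `ι` exactly up to the image of the harmonic part, i.e. iff `(F-harm)` holds.
Pure additive-group algebra; the content of §5bis is in verifying the two nestedness hypotheses
for the ten divisors (KNEST §2, §4, §5bis (a)).  Nothing here is a statement about the Hodge
conjecture.
-/

namespace Summit.Ventures.HSemireg.NumeratorInclusionCommutes

variable {C0 C1 D0 D1 H1 : Type*} [AddCommGroup C0] [AddCommGroup C1] [AddCommGroup D0]
  [AddCommGroup D1] [AddCommGroup H1]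

/-- **Commutation lemma (homotopy).** With the SDR decomposition `x = κ x + d (h x) + ip x` on the
source, `ι₁ ∘ d = d' ∘ ι₀` (chain map), `h' (ι₁ (κ x)) = 0` (degree-1 `K`-nestedness: `ι 𝒦¹ ⊆ 𝒦'¹
⊆ ker h'`) and `h' (d' (ι₀ (h x))) = ι₀ (h x)` (degree-0 `K`-nestedness), the homotopies commute
with `ι` up to the harmonic part: `h' (ι₁ x) = ι₀ (h x) + h' (ι₁ (ip x))`. -/
theorem h_comm_up_to_harmonic
    (d : C0 →+ C1) (d' : D0 →+ D1) (ι₀ : C0 →+ D0) (ι₁ : C1 →+ D1)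
    (h : C1 →+ C0) (h' : D1 →+ D0) (ip : C1 →+ C1) (κ : C1 → C1)
    (sdr : ∀ x, x = κ x + d (h x) + ip x)
    (chain : ∀ y, ι₁ (d y) = d' (ι₀ y))
    (nestK1 : ∀ x, h' (ι₁ (κ x)) = 0)
    (nestK0 : ∀ x, h' (d' (ι₀ (h x))) = ι₀ (h x))
    (x : C1) : h' (ι₁ x) = ι₀ (h x) + h' (ι₁ (ip x)) := by
  conv_lhs => rw [sdr x]
  rw [map_add, map_add, map_add, map_add, nestK1, chain, nestK0, zero_add]

/-- **Commutation lemma (projection).** Under the same decomposition, with `p' (ι₁ (κ x)) = 0`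
(`ι 𝒦¹ ⊆ 𝒦'¹ ⊆ ker p'`) and `p' ∘ d' = 0`, the projection of `ι x` only sees the harmonic part:
`p' (ι₁ x) = p' (ι₁ (ip x))`. -/
theorem p_comm_up_to_harmonic
    (d : C0 →+ C1) (d' : D0 →+ D1) (ι₀ : C0 →+ D0) (ι₁ : C1 →+ D1)
    (h : C1 →+ C0) (p' : D1 →+ H1) (ip : C1 →+ C1) (κ : C1 → C1)
    (sdr : ∀ x, x = κ x + d (h x) + ip x)
    (chain : ∀ y, ι₁ (d y) = d' (ι₀ y))
    (nestK1 : ∀ x, p' (ι₁ (κ x)) = 0)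
    (pd : ∀ z, p' (d' z) = 0)
    (x : C1) : p' (ι₁ x) = p' (ι₁ (ip x)) := by
  conv_lhs => rw [sdr x]
  rw [map_add, map_add, map_add, map_add, nestK1, chain, pd, zero_add, zero_add]

/-- **Corollary.** If moreover the harmonic representatives are carried into `ker h'`
(`(F-harm)`: `h' (ι₁ (ip x)) = 0` for all `x`), then `h' ∘ ι₁ = ι₀ ∘ h` on the whole degree-1 group —
the window-free form of RULE I's commutation entry `COMM_p(D,1)`. -/
theorem h_comm_of_harm
    (d : C0 →+ C1) (d' : D0 →+ D1) (ι₀ : C0 →+ D0) (ι₁ : C1 →+ D1)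
    (h : C1 →+ C0) (h' : D1 →+ D0) (ip : C1 →+ C1) (κ : C1 → C1)
    (sdr : ∀ x, x = κ x + d (h x) + ip x)
    (chain : ∀ y, ι₁ (d y) = d' (ι₀ y))
    (nestK1 : ∀ x, h' (ι₁ (κ x)) = 0)
    (nestK0 : ∀ x, h' (d' (ι₀ (h x))) = ι₀ (h x))
    (harm : ∀ x, h' (ι₁ (ip x)) = 0)
    (x : C1) : h' (ι₁ x) = ι₀ (h x) := by
  rw [h_comm_up_to_harmonic d d' ι₀ ι₁ h h' ip κ sdr chain nestK1 nestK0 x, harm, add_zero]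

end Summit.Ventures.HSemireg.NumeratorInclusionCommutes
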